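/-
Copyright (c) 2026 the pub-hodgecm-mathlib formalisation cell (harness21).  Prover seat hodgecm-mathlib-R90-C131-p04 (g3) on the S4 valve (dealer K2E2-plan (g8), S4-R53 (2)
(TL-c′-W)), road (J̃♭) «TJ-LOC», part 1 of 2: THE ε-TWISTED TUBE OVER A COSET WINDOW AT A NON-INTEGRAL BASE POINT (transversal × window form, with LOSS) —
the loss twins of ★ (TJ4) part 1 `R90S4TwistedTubeWindows` over ★ (TL-b′) `R90S4TwistedTubeCoreLoss`.
Crux H413 `stmt-HodgeConjecture-24833`, lane `--supports … --as helper` (count-neutral).  THEOREMS ONLY (no `def`, no `instance`, no notation, no named-fact hypothesis, no `sorry`).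
-/
import Summits.HodgeConjecture.HodgeConjecture.Theorems.R90S4TwistedTubeCoreLoss         -- ★ (TL-b′): `valBound_conj_of_mem_level_loss`, `twisted_newton_slot_loss`, `twisted_mem_level_slot_loss`, `tube_eq_mul_chart_twisted_slot_loss` (brings ★ (TL-a), ★ (TJ2), ★ C8b-core)
import Summits.HodgeConjecture.HodgeConjecture.Theorems.R90S4TwistedTubeWindows          -- ★ (TJ4) part 1 (this seat): `image_pM_subBox_subset` (brings ★ C8b-tube∕window∕product, ★ C1)
import HarnessLib

/-!
# R90-TF · S4 (Ch. 13.1–2) · road (J̃♭) «TJ-LOC», FILE (TL-c′-W) part 1: THE ε-TWISTED TUBE OVER A COSET WINDOW AT A NON-INTEGRAL BASE POINT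

Cell `hodgecm-mathlib`, crux H413 (`stmt-HodgeConjecture-24833`, lane `--supports … --as helper`), route of record `HCCMUnconditional` (no route verbs;
count-neutral).  Programme R90-TF, section S4 = [Rogawski1990] Ch. 13.1–13.2 (twisted Weyl integration formula, §12.5 p. 186); seat R90-C131-p04 (g3);
ORDER = S4 dealer K2E2-plan (g8) S4-R53 (2) (TL-c′-W): ★ W-LOC `R90S4TwistedTubeSocket` with ★ (TL-b′)'s four loss heads in place of ★ (TJ2)'s and the DATUM
letters `(γ, γ′, a, k₀)` as explicit binders (no datum computation inside).  THEOREMS ONLY — Mathlib + ★ (TL-a), (TL-b′), (TJ2), (TJ4) part 1, ★ C8b-*; ★-only imports.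

SETTING = ★ (TJ4) part 1's (★ (C4) chart frame; `pM + pT = id`; sub-box `Λ′`; `T ≤ G` linked to `ker pM` through the chart; slot data `(E, L, Θ)`; twist `ε`; the family
`Ψ (x, b) = x b ε(x)⁻¹`; the transversal `M₀ = c '' (pM '' Λ′ k)`) EXCEPT that the base point `t₀ ∈ T` is NO LONGER INTEGRAL: `ρ t₀ ≤ γ`, `ρ t₀⁻¹ ≤ γ′` entrywise with
**`γ′ · γ · α^a ≤ 1`** (loss exponent `a`; ★ (TJ4) is `a = 0`), the level shifts of `pM`, `pT`, `pM ∘ L⁻¹`, `pT ∘ L⁻¹` hold at depth `k₀`, and the START DEPTH `k` of the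
sub-box satisfies `a ≤ k` (pointwise statements) ∕ `k₀ + 2a ≤ k` (Newton statements) — [Rogawski1990, §12.5 p. 186]'s hyperbolic base point, and the non-trivial
norm-one sheets of the elliptic tori at inert places (FINDING 3 of this seat, R90 bus 2026-09-05).

THE RESULTS (all PROVED; loss twins of the named ★ (TJ4) part 1 decls, proofs token-for-token with ★ (TL-b′) in place of ★ (TJ2)).
* §0 `levelShift_mono` — a level-shift hypothesis at depth `k₀` implies the same at every depth `k ≥ k₀`.
* §1 `continuousOn_twisted_slot_loss` — `Θ` is continuous on `Λ′ k` (`a ≤ k`).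
* §2 **`twistedTube_image_eq_loss`**, **`exists_param_twisted_loss`** — the tube over the coset window and its parametrisation (★ (TL-b′) `tube_eq_mul_chart_twisted_slot_loss`; `a ≤ k`).
* §3 **`isOpen_image_twisted_slot_loss`** — `Θ(A)` is open (★ (TL-b′) `twisted_newton_slot_loss`; `k₀ + 2a ≤ k`).

Purpose: consumed by (TL-c′-W) part 2 `R90S4TwistedTubeSocketLoss` (`twistedTubeJacobianLocal_of_chartData_loss`), then by K2E4-p11 (g10)'s (TL-d)
`R90S4TwistedTubeJacobianM` (the `M` row) and — per FINDING 3 — by the elliptic rows at their non-integral sheets.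
HONEST LABEL: HC_CM is proved only modulo the 7 printed citations (2 remaining named inputs: hLiu418 = `stmt-HodgeConjecture-24832`, h413 =
`stmt-HodgeConjecture-24833`) until rung 0 closes; this file closes no socket (REL ≠ ★ ≠ BUILT; count-neutral).

## References
* [Rogawski1990] J. D. Rogawski, *Automorphic Representations of Unitary Groups in Three Variables*, Ann. of Math. Stud. 123 (1990), §12.5 p. 186. Context locator.
* [HarishChandra1970] Harish-Chandra (notes by G. van Dijk), *Harmonic Analysis on Reductive p-adic Groups*, LNM 162 (1970), Lemma 22. Context locator.
* [Serre1992LALG] J.-P. Serre, *Lie Algebras and Lie Groups*, LNM 1500 (1992), Part II Ch. IV §8–§9. Context locator.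
-/

set_option autoImplicit false
-- the mandated namespace repeats the single-problem summit's segment (`HodgeConjecture.HodgeConjecture`)
set_option linter.dupNamespace false

open Set Filter MeasureTheory MeasureTheory.Measure TopologicalSpace Topology Matrix ValuativeRel
open Literature.NumberTheory.Automorphic Literature.NumberTheory.Weil1982.UnitaryFinTopForm Literature.MeasureTheory.Group
open Summit.HodgeConjecture.HodgeConjecture.Cruxes.H413.F0P3cStCharTSCayleyChartHaar
open Summit.HodgeConjecture.HodgeConjecture.Cruxes.H413.F0P3cStCharTSFilteredNewton
open Summit.HodgeConjecture.HodgeConjecture.Cruxes.H413.F0P3cStCharTSTwistedTubeCore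
open Summit.HodgeConjecture.HodgeConjecture.Cruxes.H413.F0P3cStCharTSJacCartanProduct
open Summit.HodgeConjecture.HodgeConjecture.Cruxes.H413.F0P3cStCharTSJacCartanWindow
open scoped Pointwise Topology ENNReal NNReal MatrixGroups

namespace Summit.HodgeConjecture.HodgeConjecture.R90.S4

/-! ## §0 Level shifts are monotone in the depth -/

section Shift

variable {V : Type*} [AddCommGroup V] (Λ : ℕ → AddSubgroup V)

/-- A level-shift hypothesis stated at depth `k₀` holds at every depth `k ≥ k₀` (the levels decrease). [cite: Serre1992LALG, Part II Ch. IV §9] -/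
theorem levelShift_mono (hanti : Antitone Λ) {P : ℕ → V → Prop} {k₀ k : ℕ} (hle : k₀ ≤ k)
    (hshift : ∀ j, ∀ Z ∈ Λ (j + k₀), P j Z) : ∀ j, ∀ Z ∈ Λ (j + k), P j Z :=
  fun j Z hZ => hshift j Z (hanti (by omega) hZ)

end Shift

/-! ## §1 Continuity of the ε-twisted tube map on the sub-box, non-integral base point -/

section Continuity

variable {K : Type*} [Field K] [ValuativeRel K] [TopologicalSpace K] [IsNonarchimedeanLocalField K]
  {m : Type*} [Fintype m] [DecidableEq m]
  {V : Type*} [AddCommGroup V] [TopologicalSpace V]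
  (ι : V →+ Matrix m m K) (Λ : ℕ → AddSubgroup V) {α : ValueGroupWithZero K} (pM pT : V →+ V) {Λ' : ℕ → AddSubgroup V} (Θ : V → V)
  (E : Matrix m m K →+ Matrix m m K) {k : ℕ}

/-- **The ε-twisted tube map `Θ` is continuous on the sub-box `Λ′ k`, `k ≥ a`, at a non-integral base point** (`T ≤ γ`, `T⁻¹ ≤ γ′`, `γ′γα^a ≤ 1`: the conjugated
slot sits at radius `α^(k−a+1) < 1`, ★ (TL-b′) `valBound_conj_of_mem_level_loss`) — loss twin of ★ (TJ4) `continuousOn_twisted_slot`.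
[cite: HarishChandra1970, Lemma 22] [cite: Rogawski1990, §12.5 p. 186] -/
theorem continuousOn_twisted_slot_loss (hι : IsClosedEmbedding ι) (hΛ : ∀ j X, X ∈ Λ j ↔ ValBound (α ^ (j + 1)) (ι X)) (hα1 : α < 1)
    (hΛ' : ∀ j Z, Z ∈ Λ' j ↔ (pM Z ∈ Λ j ∧ pT Z ∈ Λ j)) (hpMc : Continuous pM) (hpTc : Continuous pT)
    {T Tinv : Matrix m m K} {γ γ' : ValueGroupWithZero K} {a : ℕ} (hT : ValBound γ T) (hTinv : ValBound γ' Tinv) (hloss : γ' * γ * α ^ a ≤ 1) (hk : a ≤ k)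
    (hE : ∀ (δ : ValueGroupWithZero K) (W : Matrix m m K), ValBound δ W → ValBound δ (E W)) (hEc : Continuous E)
    (hΘ : ∀ Z ∈ Λ' k, ι (Θ Z) =
      (fun W X : Matrix m m K => (1 - W)⁻¹ * (W + X) * (1 + W * X)⁻¹ * (1 - W)) (Tinv * ι (pM Z) * T)
        ((fun W X : Matrix m m K => (1 - W)⁻¹ * (W + X) * (1 + W * X)⁻¹ * (1 - W)) (ι (pT Z)) (E (ι (pM Z))))) :
    ContinuousOn Θ (Λ' k : Set V) := by
  obtain ⟨n, rfl⟩ : ∃ n, k = a + n := ⟨k - a, by omega⟩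
  rw [hι.isInducing.continuousOn_iff]
  have hαk1 : α ^ (a + n + 1) < 1 := pow_lt_one₀ zero_le hα1 (Nat.succ_ne_zero _)
  have hαn1 : α ^ (n + 1) < 1 := pow_lt_one₀ zero_le hα1 (Nat.succ_ne_zero _)
  set S : Matrix m m K × Matrix m m K → Matrix m m K := fun p => (1 - p.1)⁻¹ * (p.1 + p.2) * (1 + p.1 * p.2)⁻¹ * (1 - p.1) with hS
  refine ContinuousOn.congr (f := fun Z => S (Tinv * ι (pM Z) * T, S (ι (pT Z), E (ι (pM Z))))) ?_
    (fun Z hZ => by simpa only [Function.comp_apply, hS] using hΘ Z hZ)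
  intro Z hZ
  obtain ⟨hM, hT'⟩ := (hΛ' _ Z).1 hZ
  have hMb := valBound_of_mem_level ι Λ hΛ hM
  have hTb := valBound_of_mem_level ι Λ hΛ hT'
  have hEb : ValBound (α ^ (a + n + 1)) (E (ι (pM Z))) := hE _ _ hMb
  have hinner : ContinuousAt (fun Z : V => S (ι (pT Z), E (ι (pM Z)))) Z :=
    ContinuousAt.comp (g := S) (f := fun Z : V => (ι (pT Z), E (ι (pM Z)))) (continuousAt_sandwich_of_valBound hTb hEb hαk1 hαk1.le)
      ((hι.continuous.comp hpTc).prodMk (hEc.comp (hι.continuous.comp hpMc))).continuousAt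
  have hconj : Continuous fun Z : V => Tinv * ι (pM Z) * T := (continuous_const.mul (hι.continuous.comp hpMc)).mul continuous_const
  have hSb : ValBound (α ^ (a + n + 1)) (S (ι (pT Z), E (ι (pM Z)))) := by
    simpa only [hS, max_self] using valBound_cayleySandwich hTb hEb hαk1 hαk1
  have hW : ValBound (α ^ (n + 1)) (Tinv * ι (pM Z) * T) := valBound_conj_of_mem_level_loss ι Λ hΛ hα1.le hT hTinv hloss le_rfl hM
  exact (ContinuousAt.comp (g := S) (f := fun Z : V => (Tinv * ι (pM Z) * T, S (ι (pT Z), E (ι (pM Z)))))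
    (continuousAt_sandwich_of_valBound hW hSb hαn1 hαk1.le) (hconj.continuousAt.prodMk hinner)).continuousWithinAt

end Continuity

/-! ## §2 The ε-twisted tube over a coset window, non-integral base point -/

section Tube

variable {K : Type*} [Field K] [ValuativeRel K] [TopologicalSpace K] [IsNonarchimedeanLocalField K]
  {m : Type*} [Fintype m] [DecidableEq m]
  {V : Type*} [AddCommGroup V] [TopologicalSpace V] [IsTopologicalAddGroup V] [T2Space V]
  {G : Type*} [Group G]
  (ι : V →+ Matrix m m K) (Λ : ℕ → AddSubgroup V) {α : ValueGroupWithZero K} (ρ : G →* GL m K) (c : V → G)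
  (pM pT : V →+ V) {Λ' : ℕ → AddSubgroup V} (L : V ≃ₜ+ V) (Θ : V → V) (E : Matrix m m K →+ Matrix m m K) (ε : G → G)
  (T : Subgroup G) {t₀ : G} {γ γ' : ValueGroupWithZero K} {a k₀ k : ℕ}

omit [TopologicalSpace K] [IsNonarchimedeanLocalField K] [TopologicalSpace V] [IsTopologicalAddGroup V] [T2Space V] in
/-- **THE ε-TWISTED TUBE OVER THE COSET WINDOW AT A NON-INTEGRAL BASE POINT**: `Ψ '' (M₀ ×ˢ {b ∈ T | b ∈ t₀·c(Y + Λ_j)}) = t₀ · c(Θ{Z ∈ Λ′_k | pT Z ∈ Y + Λ_j})`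
for the family `Ψ (x, b) = x b ε(x)⁻¹`, the transversal `M₀ = c '' (pM '' Λ′ k)`, `k ≥ a` — ★ (TL-b′) `tube_eq_mul_chart_twisted_slot_loss`; loss twin of ★ (TJ4)
`twistedTube_image_eq`. [cite: Rogawski1990, §12.5 p. 186] [cite: HarishChandra1970, Lemma 22] -/
theorem twistedTube_image_eq_loss (hΛ : ∀ j X, X ∈ Λ j ↔ ValBound (α ^ (j + 1)) (ι X)) (hα1 : α < 1)
    (hρinj : Function.Injective ρ) (hc : ∀ X ∈ Λ 0, ((ρ (c X) : GL m K) : Matrix m m K) = cayley (ι X))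
    (hΛ' : ∀ j Z, Z ∈ Λ' j ↔ (pM Z ∈ Λ j ∧ pT Z ∈ Λ j)) (hsum : ∀ Z, pM Z + pT Z = Z) (hidem : ∀ Z, pM (pM Z) = pM Z)
    (hcT : ∀ Y ∈ Λ 0, pM Y = 0 → c Y ∈ T) (hTc : ∀ W ∈ Λ 0, c W ∈ T → pM W = 0) (ht₀ : t₀ ∈ T)
    (hT : ValBound γ ((ρ t₀ : GL m K) : Matrix m m K)) (hTinv : ValBound γ' (((ρ t₀)⁻¹ : GL m K) : Matrix m m K)) (hloss : γ' * γ * α ^ a ≤ 1) (hk : a ≤ k)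
    (hE : ∀ (δ : ValueGroupWithZero K) (W : Matrix m m K), ValBound δ W → ValBound δ (E W))
    (hε : ∀ X ∈ Λ 0, (((ρ (ε (c X)))⁻¹ : GL m K) : Matrix m m K) = cayley (E (ι X)))
    (hΘ : ∀ Z ∈ Λ' k, ι (Θ Z) =
      (fun W X : Matrix m m K => (1 - W)⁻¹ * (W + X) * (1 + W * X)⁻¹ * (1 - W)) ((((ρ t₀)⁻¹ : GL m K) : Matrix m m K) * ι (pM Z) * ((ρ t₀ : GL m K) : Matrix m m K))
        ((fun W X : Matrix m m K => (1 - W)⁻¹ * (W + X) * (1 + W * X)⁻¹ * (1 - W)) (ι (pT Z)) (E (ι (pM Z)))))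
    (Ψ : G × ↥T → G) (hΨ : ∀ (x : G) (b : ↥T), Ψ (x, b) = x * b * (ε x)⁻¹)
    {j : ℕ} (hj : k ≤ j) {Y : V} (hY : Y ∈ Λ k) :
    Ψ '' ((c '' (pM '' (Λ' k : Set V))) ×ˢ {b : ↥T | (b : G) ∈ t₀ • c '' (Y +ᵥ (Λ j : Set V))}) =
      t₀ • c '' (Θ '' ((Λ' k : Set V) ∩ pT ⁻¹' (Y +ᵥ (Λ j : Set V)))) := by
  have hanti := level_antitone ι Λ hΛ hα1.le
  have hk0 : Λ k ≤ Λ 0 := hanti (Nat.zero_le k)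
  have hjk : Λ j ≤ Λ k := hanti hj
  have hP := proj_ids pM pT hsum hidem
  have htube : ∀ Z ∈ Λ' k, c (pM Z) * t₀ * c (pT Z) * (ε (c (pM Z)))⁻¹ = t₀ * c (Θ Z) := fun Z hZ =>
    tube_eq_mul_chart_twisted_slot_loss ι Λ ρ c pM pT Θ E ε t₀ hΛ hα1 hρinj hc hΛ' hT hTinv hloss hk hE hε hΘ hZ
  -- cosets `Y + Λ j ⊆ Λ k`
  have hYcos : Y +ᵥ (Λ j : Set V) ⊆ (Λ k : Set V) := by
    rintro _ ⟨y, hy, rfl⟩; exact add_mem hY (hjk hy)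
  apply Subset.antisymm
  · rintro _ ⟨⟨x, b⟩, ⟨hx, hb⟩, rfl⟩
    obtain ⟨_, ⟨Z₁, hZ₁, rfl⟩, rfl⟩ := hx
    obtain ⟨hZ₁M, -⟩ := (hΛ' k Z₁).1 hZ₁
    obtain ⟨_, ⟨W, hW, rfl⟩, hbW⟩ := hb
    have hbW' : t₀ * c W = (b : G) := hbW
    have hWk : W ∈ Λ k := hYcos hW
    have hcWT : c W ∈ T := by
      have : c W = t₀⁻¹ * (b : G) := by rw [← hbW', inv_mul_cancel_left]
      rw [this]; exact T.mul_mem (T.inv_mem ht₀) b.2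
    have hW0 : pM W = 0 := hTc W (hk0 hWk) hcWT
    set Z := pM Z₁ + W with hZdef
    have hZM : pM Z = pM Z₁ := by rw [hZdef, map_add, hidem, hW0, add_zero]
    have hZT : pT Z = W := by rw [hZdef, map_add, (hP Z₁).2.2.1, zero_add, (hP W).2.2.2.2 hW0]
    have hZ : Z ∈ Λ' k := (hΛ' k Z).2 ⟨by rw [hZM]; exact hZ₁M, by rw [hZT]; exact hWk⟩
    have hZA : Z ∈ (Λ' k : Set V) ∩ pT ⁻¹' (Y +ᵥ (Λ j : Set V)) := ⟨hZ, by show pT Z ∈ Y +ᵥ (Λ j : Set V); rw [hZT]; exact hW⟩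
    refine ⟨c (Θ Z), ⟨Θ Z, ⟨Z, hZA, rfl⟩, rfl⟩, ?_⟩
    show t₀ • c (Θ Z) = Ψ (c (pM Z₁), b)
    rw [hΨ, ← hbW', smul_eq_mul, ← htube Z hZ, hZM, hZT, ← mul_assoc]
  · rintro _ ⟨_, ⟨_, ⟨Z, ⟨hZ, hZY⟩, rfl⟩, rfl⟩, rfl⟩
    have hZY' : pT Z ∈ Y +ᵥ (Λ j : Set V) := hZY
    obtain ⟨-, hZT⟩ := (hΛ' k Z).1 hZ
    have hx : c (pM Z) ∈ c '' (pM '' (Λ' k : Set V)) := ⟨pM Z, ⟨Z, hZ, rfl⟩, rfl⟩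
    have hbT : t₀ * c (pT Z) ∈ T := T.mul_mem ht₀ (hcT _ (hk0 hZT) (hP Z).2.1)
    refine ⟨(c (pM Z), ⟨t₀ * c (pT Z), hbT⟩), ⟨hx, ?_⟩, ?_⟩
    · show t₀ * c (pT Z) ∈ t₀ • c '' (Y +ᵥ (Λ j : Set V))
      exact ⟨c (pT Z), ⟨pT Z, hZY', rfl⟩, rfl⟩
    · show Ψ (c (pM Z), ⟨t₀ * c (pT Z), hbT⟩) = t₀ • c (Θ Z)
      rw [hΨ, smul_eq_mul, ← htube Z hZ, ← mul_assoc]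

omit [TopologicalSpace K] [IsNonarchimedeanLocalField K] [TopologicalSpace V] [IsTopologicalAddGroup V] [T2Space V] in
/-- **Parametrisation of the ε-twisted tube over a coset window at a non-integral base point**: every `(x, b) ∈ M₀ × {b | b ∈ t₀·c(Y + Λ_j)}` is
`(c (pM Z), t₀ c (pT Z))` for some `Z ∈ Λ′_k` with `pT Z ∈ Y + Λ_j`, and then `Ψ (x, b) = t₀ · c(Θ Z)` (`k ≥ a`) — loss twin of ★ (TJ4) `exists_param_twisted`.
[cite: HarishChandra1970, Lemma 22] [cite: Rogawski1990, §12.5 p. 186] -/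
theorem exists_param_twisted_loss (hΛ : ∀ j X, X ∈ Λ j ↔ ValBound (α ^ (j + 1)) (ι X)) (hα1 : α < 1)
    (hρinj : Function.Injective ρ) (hc : ∀ X ∈ Λ 0, ((ρ (c X) : GL m K) : Matrix m m K) = cayley (ι X))
    (hΛ' : ∀ j Z, Z ∈ Λ' j ↔ (pM Z ∈ Λ j ∧ pT Z ∈ Λ j)) (hsum : ∀ Z, pM Z + pT Z = Z) (hidem : ∀ Z, pM (pM Z) = pM Z)
    (hTc : ∀ W ∈ Λ 0, c W ∈ T → pM W = 0) (ht₀ : t₀ ∈ T)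
    (hT : ValBound γ ((ρ t₀ : GL m K) : Matrix m m K)) (hTinv : ValBound γ' (((ρ t₀)⁻¹ : GL m K) : Matrix m m K)) (hloss : γ' * γ * α ^ a ≤ 1) (hk : a ≤ k)
    (hE : ∀ (δ : ValueGroupWithZero K) (W : Matrix m m K), ValBound δ W → ValBound δ (E W))
    (hε : ∀ X ∈ Λ 0, (((ρ (ε (c X)))⁻¹ : GL m K) : Matrix m m K) = cayley (E (ι X)))
    (hΘ : ∀ Z ∈ Λ' k, ι (Θ Z) =
      (fun W X : Matrix m m K => (1 - W)⁻¹ * (W + X) * (1 + W * X)⁻¹ * (1 - W)) ((((ρ t₀)⁻¹ : GL m K) : Matrix m m K) * ι (pM Z) * ((ρ t₀ : GL m K) : Matrix m m K))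
        ((fun W X : Matrix m m K => (1 - W)⁻¹ * (W + X) * (1 + W * X)⁻¹ * (1 - W)) (ι (pT Z)) (E (ι (pM Z)))))
    (Ψ : G × ↥T → G) (hΨ : ∀ (x : G) (b : ↥T), Ψ (x, b) = x * b * (ε x)⁻¹)
    {j : ℕ} (hj : k ≤ j) {Y : V} (hY : Y ∈ Λ k) {x : G} {b : ↥T}
    (hx : x ∈ c '' (pM '' (Λ' k : Set V))) (hb : (b : G) ∈ t₀ • c '' (Y +ᵥ (Λ j : Set V))) :
    ∃ Z ∈ (Λ' k : Set V) ∩ pT ⁻¹' (Y +ᵥ (Λ j : Set V)), x = c (pM Z) ∧ (b : G) = t₀ * c (pT Z) ∧ Ψ (x, b) = t₀ * c (Θ Z) := by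
  have hanti := level_antitone ι Λ hΛ hα1.le
  have hk0 : Λ k ≤ Λ 0 := hanti (Nat.zero_le k)
  have hjk : Λ j ≤ Λ k := hanti hj
  have hP := proj_ids pM pT hsum hidem
  obtain ⟨_, ⟨Z₁, hZ₁, rfl⟩, rfl⟩ := hx
  obtain ⟨hZ₁M, -⟩ := (hΛ' k Z₁).1 hZ₁
  obtain ⟨_, ⟨W, hW, rfl⟩, hbW⟩ := hb
  have hbW' : t₀ * c W = (b : G) := hbW
  have hWk : W ∈ Λ k := by obtain ⟨y, hy, rfl⟩ := hW; exact add_mem hY (hjk hy)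
  have hcWT : c W ∈ T := by
    have : c W = t₀⁻¹ * (b : G) := by rw [← hbW', inv_mul_cancel_left]
    rw [this]; exact T.mul_mem (T.inv_mem ht₀) b.2
  have hW0 : pM W = 0 := hTc W (hk0 hWk) hcWT
  have hZM : pM (pM Z₁ + W) = pM Z₁ := by rw [map_add, hidem, hW0, add_zero]
  have hZT : pT (pM Z₁ + W) = W := by rw [map_add, (hP Z₁).2.2.1, zero_add, (hP W).2.2.2.2 hW0]
  have hZ : pM Z₁ + W ∈ Λ' k := (hΛ' k _).2 ⟨by rw [hZM]; exact hZ₁M, by rw [hZT]; exact hWk⟩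
  refine ⟨pM Z₁ + W, ⟨hZ, by show pT (pM Z₁ + W) ∈ Y +ᵥ (Λ j : Set V); rw [hZT]; exact hW⟩, ?_, ?_, ?_⟩
  · rw [hZM]
  · rw [hZT, hbW']
  · rw [hΨ, ← hbW', ← tube_eq_mul_chart_twisted_slot_loss ι Λ ρ c pM pT Θ E ε t₀ hΛ hα1 hρinj hc hΛ' hT hTinv hloss hk hE hε hΘ hZ, hZM, hZT, ← mul_assoc]

/-! ## §3 The image `Θ(A)` is open, non-integral base point -/

omit [Group G] in
/-- **`Θ(A)` is open** for `A = {Z ∈ Λ′_k | pT Z ∈ Y + Λ_j}`, `j ≥ k ≥ k₀ + 2a`: `A` is a union of `Λ′_j`-cosets and the ε-twisted tube map sends `Z + Λ′_j` onto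
`Θ Z + L(Λ′_j)` (★ C1 `image_vadd_eq_of_linearNewton` with ★ (TL-b′) `twisted_newton_slot_loss`) — loss twin of ★ (TJ4) `isOpen_image_twisted_slot`.
[cite: Serre1992LALG, Part II Ch. IV §8] [cite: Rogawski1990, §12.5 p. 186] -/
theorem isOpen_image_twisted_slot_loss (hι : IsClosedEmbedding ι) (hΛ : ∀ j X, X ∈ Λ j ↔ ValBound (α ^ (j + 1)) (ι X)) (hα : α ≠ 0) (hα1 : α < 1)
    (hΛ' : ∀ j Z, Z ∈ Λ' j ↔ (pM Z ∈ Λ j ∧ pT Z ∈ Λ j)) (hsum : ∀ Z, pM Z + pT Z = Z)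
    (hpMc : Continuous pM) (hpTc : Continuous pT) (hshift : ∀ j, ∀ Z ∈ Λ (j + k₀), pM Z ∈ Λ j ∧ pT Z ∈ Λ j)
    {Tm Tinv : Matrix m m K} (hT : ValBound γ Tm) (hTinv : ValBound γ' Tinv) (hloss : γ' * γ * α ^ a ≤ 1) (hk : k₀ + 2 * a ≤ k)
    (hE : ∀ (δ : ValueGroupWithZero K) (W : Matrix m m K), ValBound δ W → ValBound δ (E W)) (hEc : Continuous E)
    (hL : ∀ Z, ι (L Z) = Tinv * ι (pM Z) * Tm + E (ι (pM Z)) + ι (pT Z))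
    (hΘ : ∀ Z ∈ Λ' k, ι (Θ Z) =
      (fun W X : Matrix m m K => (1 - W)⁻¹ * (W + X) * (1 + W * X)⁻¹ * (1 - W)) (Tinv * ι (pM Z) * Tm)
        ((fun W X : Matrix m m K => (1 - W)⁻¹ * (W + X) * (1 + W * X)⁻¹ * (1 - W)) (ι (pT Z)) (E (ι (pM Z)))))
    (hshiftL : ∀ j, ∀ Z ∈ Λ (j + k₀), pM (L.symm Z) ∈ Λ j ∧ pT (L.symm Z) ∈ Λ j)
    {j : ℕ} (hj : k ≤ j) (Y : V) : IsOpen (Θ '' ((Λ' k : Set V) ∩ pT ⁻¹' (Y +ᵥ (Λ j : Set V)))) := by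
  have hanti := level_antitone ι Λ hΛ hα1.le
  have hanti' : Antitone Λ' := subBox_antitone hΛ' hanti
  have hopenΛ := isOpen_level ι Λ hι.continuous hΛ hα
  have hopen' := isOpen_subBox hΛ' hopenΛ hshift
  set A := (Λ' k : Set V) ∩ pT ⁻¹' (Y +ᵥ (Λ j : Set V)) with hA
  have hcos : ∀ Z ∈ A, Z +ᵥ (Λ' j : Set V) ⊆ A := by
    rintro Z ⟨hZk, hZj⟩ _ ⟨y, hy, rfl⟩
    refine ⟨add_mem hZk (hanti' hj hy), ?_⟩
    obtain ⟨w, hw, hwZ⟩ := (hZj : pT Z ∈ Y +ᵥ (Λ j : Set V))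
    have hwZ' : Y + w = pT Z := hwZ
    show pT (Z + y) ∈ Y +ᵥ (Λ j : Set V)
    refine ⟨w + pT y, add_mem hw ((hΛ' j y).1 hy).2, ?_⟩
    show Y + (w + pT y) = pT (Z + y)
    rw [map_add, ← hwZ', add_assoc]
  have hunion : Θ '' A = ⋃ Z ∈ A, Θ '' (Z +ᵥ (Λ' j : Set V)) := by
    apply Subset.antisymm
    · rintro _ ⟨Z, hZ, rfl⟩
      exact mem_iUnion₂.2 ⟨Z, hZ, ⟨Z, ⟨0, zero_mem _, by simp⟩, rfl⟩⟩
    · exact iUnion₂_subset fun Z hZ => image_mono (hcos Z hZ)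
  rw [hunion]
  refine isOpen_biUnion fun Z hZ => ?_
  rw [image_vadd_eq_of_linearNewton Λ' Θ L hanti' hopen' (isCompact_subBox hΛ' hopenΛ (isCompact_level ι Λ hι hΛ) hshift hsum k)
    (subBox_basis hΛ' hsum (exists_level_subset_of_mem_nhds ι Λ hι hΛ hα1))
    (continuousOn_twisted_slot_loss ι Λ pM pT Θ E hι hΛ hα1 hΛ' hpMc hpTc hT hTinv hloss (by omega) hE hEc hΘ)
    (twisted_newton_slot_loss ι Λ pM pT L Θ E hΛ hα1 hΛ' hT hTinv hloss hk hE hL hΘ hshiftL) hj hZ.1]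
  exact (L.toHomeomorph.isOpenMap _ (hopen' j)).vadd _

end Tube

end Summit.HodgeConjecture.HodgeConjecture.R90.S4
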